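import Literature.Topology.FourManifolds.TautFoliationsFences
import Literature.Topology.FourManifolds.TautFoliationsHolonomyOriented
import HarnessLib

/-!
# The suspension collar of a leaf loop

For a transversely oriented `C⁰` codimension-one foliation `F : Literature.Topology.FourManifolds.Foliation B M`
and a **leaf loop** `ℓ : Path x₀ x₀` (a loop continuous in the leaf topology) with a flow box
`e₀ ∋ x₀` of the atlas, we build the local picture of `F` along `ℓ` that starts all disc
arguments of Novikov's theorem (Camacho–Lins Neto, *Geometric Theory of Foliations*, Ch. IV
§2–§3 and Ch. VII §2: the "positive normal extension" of a leaf curve and its holonomy):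

* `IsTransverselyOriented.exists_suspensionFence` (**proved**): a **fence over the loop with
  matched ends** — a level radius `ε > 0`, an increasing homeomorphism `φ₁` of the level
  interval representing the holonomy germ of `ℓ` in `e₀` (`holonomyGerm = ↑φ₁`,
  `TautFoliationsHolonomy.lean`, `TautFoliationsHolonomyOriented.lean`) with inverse `ψ₁`, and
  a fence `Φ : I → ℝ → M` over the parameter interval (`TautFoliationsFences.lean`: jointly
  continuous, `Φ θ τ₀ = ℓ θ`, horizontals `θ ↦ Φ θ τ` leaf paths in the local leaves of level
  `τ`, verticals injective transversals) whose two end verticals lie on the **same** vertical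
  transversal `V τ = e₀.symm (b₀, τ)` of `e₀` through `x₀`:
  `Φ 0 τ = V τ` and `Φ 1 τ = V (ψ₁ τ)`. So the leaf of level `τ` started at `V τ` returns over
  `x₀` at `V (ψ₁ τ)`: `ψ₁` is the holonomy (first return) map of `ℓ` on `V`, `φ₁` its inverse.
* `collarLevel`, `collarMap` (**definitions**) and their properties (**proved**): the **suspension
  collar** `(θ, s) ↦ Φ θ ((1 - θ)(τ₀ + s) + θ φ₁ (τ₀ + s))` on `I × [0, s₁]`, continuous, equal
  to `ℓ` at depth `s = 0`, **closing up** (`collarMap 0 s = collarMap 1 s = V (τ₀ + s)`), with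
  levels strictly increasing in the depth (`strictMonoOn_collarLevel`: no two points of a
  vertical on the same local leaf), i.e. a map of the annulus `I × [0, s₁] / (0, s) ∼ (1, s)`
  realising near `ℓ` the suspension of the holonomy: the one-sided neighbourhood of the leaf
  loop in which the pulled-back foliation is explicit.

## References

* C. Camacho, A. Lins Neto, *Geometric Theory of Foliations*, Birkhäuser (1985), Ch. IV §2
  (Thm. 2, Lemma 4), Ch. VII §2 (normal extensions) [CamachoLinsNeto1985].
* G. Hector, U. Hirsch, *Introduction to the Geometry of Foliations, Part A* (1986), Ch. III
  2.1–2.2 [HectorHirsch1986].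
-/

open Set Filter Function Topology unitInterval

namespace Literature.Topology.FourManifolds

namespace Foliation

variable {B : Type*} [NormedAddCommGroup B] {M : Type*} [TopologicalSpace M] (F : Foliation B M)
variable {x₀ : M} {e₀ : OpenPartialHomeomorph M (B × ℝ)}

/-! ## Leaf loops as paths of the leaf space -/

/-- A loop of `M` continuous in the leaf topology, as a loop of the leaf space `M^δ`.
[folklore] -/
def leafLoop (ℓ : Path x₀ x₀) (hℓ : Continuous (toLeafSpace ∘ ℓ : I → F.LeafSpace)) :
    Path (toLeafSpace x₀ : F.LeafSpace) (toLeafSpace x₀) where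
  toFun := toLeafSpace ∘ ℓ
  continuous_toFun := hℓ
  source' := by simp
  target' := by simp

/-- The points of the leaf loop are those of the loop. [folklore] -/
@[simp] theorem ofLeafSpace_leafLoop (ℓ : Path x₀ x₀) (hℓ : Continuous (toLeafSpace ∘ ℓ : I → F.LeafSpace))
    (θ : I) : ofLeafSpace (F.leafLoop ℓ hℓ θ) = ℓ θ := rfl

/-! ## The fence over a leaf loop with matched ends -/

variable {F} in
/-- **Fence over a leaf loop with matched ends.** For a transversely oriented foliation, a
leaf loop `ℓ` at `x₀` and a flow box `e₀ ∋ x₀` of the atlas, with `τ₀ = h_{e₀}(x₀)` and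
`b₀ = (e₀ x₀).1`: there are `ε > 0`, functions `φ₁, ψ₁` continuous and strictly increasing on
the level interval `(τ₀ - ε, τ₀ + ε)`, inverse to each other there, fixing `τ₀`, with
`holonomyGerm ℓ = ↑φ₁` (the holonomy germ of `TautFoliationsHolonomy.lean`), a lift `Γ` of `ℓ`
to the germ space starting at the germ of `h_{e₀}`, and a fence `Φ` for `Γ` at level `τ₀` of
radius `ε` over the whole parameter interval, such that
`Φ 0 τ = e₀.symm (b₀, τ)` and `Φ 1 τ = e₀.symm (b₀, ψ₁ τ)` on the level interval: both end
verticals run on the vertical of `e₀` through `x₀`, and the leaf of level `τ` returns over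
`x₀` at height `ψ₁ τ` (Camacho–Lins Neto, Ch. IV §2 Thm. 2 and §3 Lemma 4, relative form with
prescribed local data at the ends). [cite: CamachoLinsNeto1985, Ch. IV §2 Thm. 2] -/
theorem IsTransverselyOriented.exists_suspensionFence [NormedSpace ℝ B] [Nonempty B]
    [LocallyConnectedSpace B] (ho : F.IsTransverselyOriented) (ℓ : Path x₀ x₀)
    (hℓ : Continuous (toLeafSpace ∘ ℓ : I → F.LeafSpace)) (he₀ : e₀ ∈ F.atlas) (hx₀ : x₀ ∈ e₀.source) :
    ∃ (ε : ℝ) (φ₁ ψ₁ : ℝ → ℝ) (Γ : C(I, F.GermSpace)) (Φ : I → ℝ → M), 0 < ε ∧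
      ContinuousOn φ₁ (Ioo ((e₀ x₀).2 - ε) ((e₀ x₀).2 + ε)) ∧
      StrictMonoOn φ₁ (Ioo ((e₀ x₀).2 - ε) ((e₀ x₀).2 + ε)) ∧
      ContinuousOn ψ₁ (Ioo ((e₀ x₀).2 - ε) ((e₀ x₀).2 + ε)) ∧
      StrictMonoOn ψ₁ (Ioo ((e₀ x₀).2 - ε) ((e₀ x₀).2 + ε)) ∧
      φ₁ (e₀ x₀).2 = (e₀ x₀).2 ∧ ψ₁ (e₀ x₀).2 = (e₀ x₀).2 ∧
      (∀ τ ∈ Ioo ((e₀ x₀).2 - ε) ((e₀ x₀).2 + ε), ψ₁ (φ₁ τ) = τ ∧ φ₁ (ψ₁ τ) = τ) ∧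
      F.holonomyGerm he₀ hx₀ (Path.Homotopic.Quotient.mk (F.leafLoop ℓ hℓ)) he₀ hx₀ = ↑φ₁ ∧
      GermSpace.proj ∘ Γ = F.leafLoop ℓ hℓ ∧ Γ 0 = GermSpace.ofHeight F he₀ (toLeafSpace x₀) hx₀ ∧
      IsFenceOn F Γ (e₀ x₀).2 ε Φ univ ∧
      (∀ τ ∈ Ioo ((e₀ x₀).2 - ε) ((e₀ x₀).2 + ε), Φ 0 τ = e₀.symm ((e₀ x₀).1, τ)) ∧
      (∀ τ ∈ Ioo ((e₀ x₀).2 - ε) ((e₀ x₀).2 + ε), Φ 1 τ = e₀.symm ((e₀ x₀).1, ψ₁ τ)) := by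
  set τ₀ : ℝ := (e₀ x₀).2 with hτ₀
  set p : F.LeafSpace := toLeafSpace x₀ with hpdef
  have hp : ofLeafSpace p ∈ e₀.source := hx₀
  set L := F.leafLoop ℓ hℓ with hL
  -- the lift of the loop to the germ space
  set Γ : C(I, F.GermSpace) := (F.isCoveringMap_proj).liftPath L (GermSpace.ofHeight F he₀ p hp)
    L.source with hΓ
  have hΓlift : GermSpace.proj ∘ Γ = L :=
    (F.isCoveringMap_proj).liftPath_lifts L (GermSpace.ofHeight F he₀ p hp) L.source
  have hΓ0 : Γ 0 = GermSpace.ofHeight F he₀ p hp :=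
    (F.isCoveringMap_proj).liftPath_zero L (GermSpace.ofHeight F he₀ p hp) L.source
  have hΓpt : ∀ θ, ofLeafSpace (Γ θ).pt = ℓ θ := fun θ ↦
    congrArg ofLeafSpace (congr_fun hΓlift θ)
  have hΓ1 : Γ 1 = F.continuation he₀ hp (Path.Homotopic.Quotient.mk L) := rfl
  have hlev : ∀ θ, GermSpace.level (Γ θ) = τ₀ := fun θ ↦ by
    rw [GermSpace.level_apply_eq_of_path Γ θ 0, hΓ0, GermSpace.level_ofHeight]
    rfl
  -- the holonomy germ, increasing, and its inverse
  obtain ⟨φ₁, hφ₁, hhol, hφ₁τ₀⟩ := F.exists_isIncrHomeoGermAt_holonomyGerm_eq ho he₀ hp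
    (Path.Homotopic.Quotient.mk L) he₀ hp
  change IsIncrHomeoGermAt φ₁ τ₀ at hφ₁
  change φ₁ τ₀ = τ₀ at hφ₁τ₀
  obtain ⟨ψ₁, hψ₁, hψ₁τ₀, hψφ, hφψ⟩ := hφ₁.exists_inverse
  rw [hφ₁τ₀] at hψ₁ hψ₁τ₀ hφψ
  -- the germ of `Γ 1` is `φ₁ ∘ h_{e₀}`
  have hgerm1 : (Γ 1).germ = ↑(φ₁ ∘ height e₀) := by
    rw [hΓ1, ← F.writeGerm_holonomyGerm he₀ hp _ he₀ hp, hhol, writeGerm_coe]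
  -- local descriptions of `Γ` near `0` and near `1`, in the box `e₀`
  have hsrc0 : ofLeafSpace (Γ 0).pt ∈ e₀.source := by rw [hΓpt, ℓ.source]; exact hx₀
  have hsrc1 : ofLeafSpace (Γ 1).pt ∈ e₀.source := by rw [hΓpt, ℓ.target]; exact hx₀
  obtain ⟨χ₀, hχ₀, U₀, hU₀, H₀⟩ := F.exists_nhds_forall_eq_germSection Γ 0 he₀ hsrc0
  obtain ⟨χ₁, hχ₁, U₁, hU₁, H₁⟩ := F.exists_nhds_forall_eq_germSection Γ 1 he₀ hsrc1
  have ht0 : (e₀ (ofLeafSpace (Γ 0).pt)).2 = τ₀ := by rw [hΓpt, ℓ.source]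
  have ht1 : (e₀ (ofLeafSpace (Γ 1).pt)).2 = τ₀ := by rw [hΓpt, ℓ.target]
  generalize (e₀ (ofLeafSpace (Γ 0).pt)).2 = t at hχ₀ H₀ ht0
  subst ht0
  generalize (e₀ (ofLeafSpace (Γ 1).pt)).2 = t at hχ₁ H₁ ht1
  subst ht1
  -- `χ₀ = id` and `χ₁ = φ₁` near `τ₀`
  have hχ₀id : χ₀ =ᶠ[𝓝 τ₀] id := by
    obtain ⟨h0pl, hG0⟩ := H₀ 0 (mem_of_mem_nhds hU₀)
    have h1 : (Γ 0).germ = ↑(χ₀ ∘ height e₀) := by rw [hG0, germSection_germ]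
    rw [hΓ0, GermSpace.ofHeight_germ] at h1
    have h2 : (↑(id ∘ height e₀) : Germ (𝓝 (ofLeafSpace p)) ℝ) = ↑(χ₀ ∘ height e₀) := h1
    exact (F.eventuallyEq_of_comp_height_eq he₀ hp h2).symm
  have hχ₁φ : χ₁ =ᶠ[𝓝 τ₀] φ₁ := by
    obtain ⟨h1pl, hG1⟩ := H₁ 1 (mem_of_mem_nhds hU₁)
    have h1 : (Γ 1).germ = ↑(χ₁ ∘ height e₀) := by rw [hG1, germSection_germ]
    rw [hgerm1] at h1
    have := (F.eventuallyEq_of_comp_height_eq he₀ hsrc1 h1).symm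
    rwa [hΓpt, ℓ.target] at this
  -- germs of `Γ` near the ends
  have hgerm_near0 : ∀ a ∈ U₀, ofLeafSpace (Γ a).pt ∈ plaque e₀ τ₀ ∧ (Γ a).germ = ↑(id ∘ height e₀) := by
    intro a ha
    obtain ⟨hpl, hGa⟩ := H₀ a ha
    refine ⟨hpl, ?_⟩
    rw [hGa, germSection_germ, Germ.coe_eq]
    -- `χ₀ ∘ h = id ∘ h` near a point of height `τ₀`
    have hc : ContinuousAt (height e₀) (ofLeafSpace (F.leafPlaqueMap e₀ τ₀
        (e₀ (ofLeafSpace (Γ a).pt)).1)) := continuousAt_height (F.plaqueMap_mem_source he₀ _ _)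
    have hval : height e₀ (ofLeafSpace (F.leafPlaqueMap e₀ τ₀ (e₀ (ofLeafSpace (Γ a).pt)).1)) = τ₀ := by
      rw [height_apply, ofLeafSpace_leafPlaqueMap, F.apply_plaqueMap he₀]
    rw [← hval] at hχ₀id
    exact hc.tendsto.eventually hχ₀id |>.mono fun y hy ↦ by simp only [comp_apply]; exact hy
  have hgerm_near1 : ∀ a ∈ U₁, ofLeafSpace (Γ a).pt ∈ plaque e₀ τ₀ ∧ (Γ a).germ = ↑(φ₁ ∘ height e₀) := by
    intro a ha
    obtain ⟨hpl, hGa⟩ := H₁ a ha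
    refine ⟨hpl, ?_⟩
    rw [hGa, germSection_germ, Germ.coe_eq]
    have hc : ContinuousAt (height e₀) (ofLeafSpace (F.leafPlaqueMap e₀ τ₀
        (e₀ (ofLeafSpace (Γ a).pt)).1)) := continuousAt_height (F.plaqueMap_mem_source he₀ _ _)
    have hval : height e₀ (ofLeafSpace (F.leafPlaqueMap e₀ τ₀ (e₀ (ofLeafSpace (Γ a).pt)).1)) = τ₀ := by
      rw [height_apply, ofLeafSpace_leafPlaqueMap, F.apply_plaqueMap he₀]
    rw [← hval] at hχ₁φ
    exact hc.tendsto.eventually hχ₁φ |>.mono fun y hy ↦ by simp only [comp_apply]; exact hy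
  -- a common radius `ε₀` for all the germ data
  obtain ⟨ρφ, hρφ, hφc, hφm⟩ := hφ₁
  obtain ⟨ρψ, hρψ, hψc, hψm⟩ := hψ₁
  obtain ⟨ρ₁, hρ₁, hρ₁sub⟩ := IsHomeoGermAt.exists_Ioo_subset_of_mem_nhds (inter_mem hψφ hφψ)
  -- `φ₁` and `ψ₁` map a small interval into the big ones
  have hφca : ContinuousAt φ₁ τ₀ := hφc.continuousAt (IsHomeoGermAt.Ioo_mem_nhds_of_pos hρφ)
  have hψca : ContinuousAt ψ₁ τ₀ := hψc.continuousAt (IsHomeoGermAt.Ioo_mem_nhds_of_pos hρψ)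
  have hbig : Ioo (τ₀ - min (min ρφ ρψ) ρ₁) (τ₀ + min (min ρφ ρψ) ρ₁) ∈ 𝓝 τ₀ :=
    IsHomeoGermAt.Ioo_mem_nhds_of_pos (lt_min (lt_min hρφ hρψ) hρ₁)
  obtain ⟨ε₀, hε₀, hε₀sub⟩ := IsHomeoGermAt.exists_Ioo_subset_of_mem_nhds (inter_mem hbig
    (inter_mem (hφca.preimage_mem_nhds (by rw [hφ₁τ₀]; exact hbig))
      (hψca.preimage_mem_nhds (by rw [hψ₁τ₀]; exact hbig))))
  -- notation for the small interval and what holds on it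
  have hJ : ∀ τ ∈ Ioo (τ₀ - ε₀) (τ₀ + ε₀),
      (τ ∈ Ioo (τ₀ - ρφ) (τ₀ + ρφ) ∧ τ ∈ Ioo (τ₀ - ρψ) (τ₀ + ρψ) ∧ ψ₁ (φ₁ τ) = τ ∧ φ₁ (ψ₁ τ) = τ) ∧
      (φ₁ τ ∈ Ioo (τ₀ - ρψ) (τ₀ + ρψ)) ∧ (ψ₁ τ ∈ Ioo (τ₀ - ρφ) (τ₀ + ρφ)) := by
    intro τ hτ
    obtain ⟨h₁, h₂, h₃⟩ := hε₀sub hτ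
    have hsmall : ∀ σ' ∈ Ioo (τ₀ - min (min ρφ ρψ) ρ₁) (τ₀ + min (min ρφ ρψ) ρ₁),
        σ' ∈ Ioo (τ₀ - ρφ) (τ₀ + ρφ) ∧ σ' ∈ Ioo (τ₀ - ρψ) (τ₀ + ρψ) ∧ σ' ∈ Ioo (τ₀ - ρ₁) (τ₀ + ρ₁) := by
      intro σ' hσ'
      have a := min_le_left (min ρφ ρψ) ρ₁
      have b := min_le_right (min ρφ ρψ) ρ₁
      have c := min_le_left ρφ ρψ
      have d := min_le_right ρφ ρψ
      exact ⟨⟨by linarith [hσ'.1], by linarith [hσ'.2]⟩, ⟨by linarith [hσ'.1], by linarith [hσ'.2]⟩,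
        ⟨by linarith [hσ'.1], by linarith [hσ'.2]⟩⟩
    obtain ⟨a₁, a₂, a₃⟩ := hsmall τ h₁
    obtain ⟨hl, hr⟩ := hρ₁sub a₃
    exact ⟨⟨a₁, a₂, hl, hr⟩, (hsmall _ h₂).2.1, (hsmall _ h₃).1⟩
  -- the two local data at the ends, in the box `e₀`
  have htarget : ∀ v : B × ℝ, v ∈ e₀.target := fun v ↦ by rw [F.target_eq e₀ he₀]; exact mem_univ _
  let D₀ : LocalDatum F Γ τ₀ ε₀ U₀ :=
    { box := e₀
      box_mem := he₀
      φ := id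
      ψ := id
      germ_eq := fun a ha ↦ (hgerm_near0 a ha).2
      pt_mem := fun a ha ↦ (hgerm_near0 a ha).1
      φ_ψ := fun _ _ ↦ rfl
      ψ_φ := Eventually.of_forall fun _ ↦ rfl
      ψ_cont := continuousOn_id
      ψ_inj := injective_id.injOn }
  let D₁ : LocalDatum F Γ τ₀ ε₀ U₁ :=
    { box := e₀
      box_mem := he₀
      φ := φ₁
      ψ := ψ₁
      germ_eq := fun a ha ↦ (hgerm_near1 a ha).2
      pt_mem := fun a ha ↦ by rw [hψ₁τ₀]; exact (hgerm_near1 a ha).1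
      φ_ψ := fun τ hτ ↦ (hJ τ hτ).1.2.2.2
      ψ_φ := by
        rw [hψ₁τ₀]
        exact hψφ.mono fun r hr ↦ hr
      ψ_cont := hψc.mono fun τ hτ ↦ (hJ τ hτ).1.2.1
      ψ_inj := hψm.injOn.mono fun τ hτ ↦ (hJ τ hτ).1.2.1 }
  -- disjoint open neighbourhoods of the ends inside `U₀`, `U₁`
  have hhalf : (1 / 2 : ℝ) ∈ I := ⟨by norm_num, by norm_num⟩
  set c : I := ⟨1 / 2, hhalf⟩ with hc
  have h0c : (0 : I) < c := Subtype.coe_lt_coe.1 (by rw [hc]; norm_num)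
  have hc1 : c < 1 := Subtype.coe_lt_coe.1 (by rw [hc]; norm_num)
  obtain ⟨O₀, hO₀U, hO₀o, h0O₀⟩ := mem_nhds_iff.1 (inter_mem hU₀ ((isOpen_gt' c).mem_nhds h0c))
  obtain ⟨O₁, hO₁U, hO₁o, h1O₁⟩ := mem_nhds_iff.1 (inter_mem hU₁ ((isOpen_lt' c).mem_nhds hc1))
  -- the initial fence over `O₀ ∪ O₁`: verticals of `e₀` through the points of the loop
  classical
  set Φ₀ : I → ℝ → M := fun a τ ↦
    if a < c then e₀.symm ((e₀ (ℓ a)).1, τ) else e₀.symm ((e₀ (ℓ a)).1, ψ₁ τ) with hΦ₀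
  have hO₀lt : ∀ a ∈ O₀, a < c := fun a ha ↦ (hO₀U ha).2
  have hO₁gt : ∀ a ∈ O₁, ¬ a < c := fun a ha ↦ not_lt.2 (le_of_lt (hO₁U ha).2)
  have hΦ₀O₀ : ∀ a ∈ O₀, ∀ τ, Φ₀ a τ = e₀.symm ((e₀ (ℓ a)).1, τ) := fun a ha τ ↦ by
    simp only [hΦ₀, if_pos (hO₀lt a ha)]
  have hΦ₀O₁ : ∀ a ∈ O₁, ∀ τ, Φ₀ a τ = e₀.symm ((e₀ (ℓ a)).1, ψ₁ τ) := fun a ha τ ↦ by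
    simp only [hΦ₀, if_neg (hO₁gt a ha)]
  -- the loop runs in the plaque of `e₀` at height `τ₀` over `O₀` and `O₁`
  have hpl0 : ∀ a ∈ O₀, ℓ a ∈ plaque e₀ τ₀ := fun a ha ↦ by
    rw [← hΓpt]; exact (hgerm_near0 a (hO₀U ha).1).1
  have hpl1 : ∀ a ∈ O₁, ℓ a ∈ plaque e₀ τ₀ := fun a ha ↦ by
    rw [← hΓpt]; exact (hgerm_near1 a (hO₁U ha).1).1
  have hfence₀ : IsFenceOn F Γ τ₀ ε₀ Φ₀ (O₀ ∪ O₁) := by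
    refine ⟨?_, ?_, ?_⟩
    · -- continuity on the two open pieces
      have hc0 : ContinuousOn (uncurry Φ₀) (O₀ ×ˢ Ioo (τ₀ - ε₀) (τ₀ + ε₀)) := by
        have : ContinuousOn (fun q : I × ℝ ↦ e₀.symm ((e₀ (ℓ q.1)).1, q.2))
            (O₀ ×ˢ Ioo (τ₀ - ε₀) (τ₀ + ε₀)) := by
          refine (F.continuous_symm_of_mem he₀).comp_continuousOn (ContinuousOn.prodMk ?_ continuousOn_snd)
          refine continuous_fst.comp_continuousOn (e₀.continuousOn.comp
            (ℓ.continuous.comp_continuousOn continuousOn_fst) fun q hq ↦ (hpl0 q.1 hq.1).1)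
        exact this.congr fun q hq ↦ hΦ₀O₀ q.1 hq.1 q.2
      have hc1 : ContinuousOn (uncurry Φ₀) (O₁ ×ˢ Ioo (τ₀ - ε₀) (τ₀ + ε₀)) := by
        have : ContinuousOn (fun q : I × ℝ ↦ e₀.symm ((e₀ (ℓ q.1)).1, ψ₁ q.2))
            (O₁ ×ˢ Ioo (τ₀ - ε₀) (τ₀ + ε₀)) := by
          refine (F.continuous_symm_of_mem he₀).comp_continuousOn (ContinuousOn.prodMk ?_ ?_)
          · refine continuous_fst.comp_continuousOn (e₀.continuousOn.comp
              (ℓ.continuous.comp_continuousOn continuousOn_fst) fun q hq ↦ (hpl1 q.1 hq.1).1)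
          · exact hψc.comp continuousOn_snd fun q hq ↦ (hJ q.2 hq.2).1.2.1
        exact this.congr fun q hq ↦ hΦ₀O₁ q.1 hq.1 q.2
      rw [union_prod]
      exact hc0.union_of_isOpen hc1 (hO₀o.prod isOpen_Ioo) (hO₁o.prod isOpen_Ioo)
    · -- base
      rintro a (ha | ha)
      · rw [hΦ₀O₀ a ha, hΓpt]
        have h := hpl0 a ha
        conv_lhs => rw [← h.2, show ((e₀ (ℓ a)).1, (e₀ (ℓ a)).2) = e₀ (ℓ a) from rfl]
        exact e₀.left_inv h.1
      · rw [hΦ₀O₁ a ha, hψ₁τ₀, hΓpt]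
        have h := hpl1 a ha
        conv_lhs => rw [← h.2, show ((e₀ (ℓ a)).1, (e₀ (ℓ a)).2) = e₀ (ℓ a) from rfl]
        exact e₀.left_inv h.1
    · -- local levels
      rintro a (ha | ha)
      · refine ⟨O₀, hO₀o.mem_nhds ha, D₀.restrict (fun a' ha' ↦ (hO₀U ha'.1).1) le_rfl, ?_⟩
        rintro a' ⟨ha', -⟩ τ hτ
        rw [hΦ₀O₀ a' ha']
        refine ⟨e₀.map_target (htarget _), ?_⟩
        rw [LocalDatum.restrict_ψ, height_apply, LocalDatum.restrict_box, e₀.right_inv (htarget _)]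
        rfl
      · refine ⟨O₁, hO₁o.mem_nhds ha, D₁.restrict (fun a' ha' ↦ (hO₁U ha'.1).1) le_rfl, ?_⟩
        rintro a' ⟨ha', -⟩ τ hτ
        rw [hΦ₀O₁ a' ha']
        refine ⟨e₀.map_target (htarget _), ?_⟩
        rw [LocalDatum.restrict_ψ, height_apply, LocalDatum.restrict_box, e₀.right_inv (htarget _)]
  -- extend to a fence over the whole interval, unchanged near the ends
  have hK : IsCompact ({0, 1} : Set I) := (Set.toFinite _).isCompact
  have hKS : ({0, 1} : Set I) ⊆ O₀ ∪ O₁ := by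
    rintro a (rfl | rfl)
    exacts [Or.inl h0O₀, Or.inr h1O₁]
  obtain ⟨ε₁, hε₁, Φ, hΦ, V, -, hKV, hagree⟩ := F.exists_isFenceOn_univ_of_isFenceOn Γ hlev hε₀
    hfence₀ (hO₀o.union hO₁o) hK hKS
  -- the final radius
  set ε : ℝ := min ε₀ ε₁ with hεdef
  have hε : 0 < ε := lt_min hε₀ hε₁
  have hεsub₀ : Ioo (τ₀ - ε) (τ₀ + ε) ⊆ Ioo (τ₀ - ε₀) (τ₀ + ε₀) :=
    Ioo_subset_Ioo (by rw [hεdef]; linarith [min_le_left ε₀ ε₁]) (by rw [hεdef]; linarith [min_le_left ε₀ ε₁])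
  have hεsub₁ : Ioo (τ₀ - ε) (τ₀ + ε) ⊆ Ioo (τ₀ - ε₁) (τ₀ + ε₁) :=
    Ioo_subset_Ioo (by rw [hεdef]; linarith [min_le_right ε₀ ε₁]) (by rw [hεdef]; linarith [min_le_right ε₀ ε₁])
  refine ⟨ε, φ₁, ψ₁, Γ, Φ, hε, hφc.mono fun τ hτ ↦ (hJ τ (hεsub₀ hτ)).1.1,
    hφm.mono fun τ hτ ↦ (hJ τ (hεsub₀ hτ)).1.1, hψc.mono fun τ hτ ↦ (hJ τ (hεsub₀ hτ)).1.2.1,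
    hψm.mono fun τ hτ ↦ (hJ τ (hεsub₀ hτ)).1.2.1, hφ₁τ₀, hψ₁τ₀,
    fun τ hτ ↦ ⟨(hJ τ (hεsub₀ hτ)).1.2.2.1, (hJ τ (hεsub₀ hτ)).1.2.2.2⟩, hhol, hΓlift, hΓ0,
    hΦ.mono (subset_univ _) (min_le_right _ _), fun τ hτ ↦ ?_, fun τ hτ ↦ ?_⟩
  · rw [hagree 0 (hKV (Or.inl rfl)) τ (hεsub₁ hτ), hΦ₀O₀ 0 h0O₀, ℓ.source]
  · rw [hagree 1 (hKV (Or.inr rfl)) τ (hεsub₁ hτ), hΦ₀O₁ 1 h1O₁, ℓ.target]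

/-! ## The suspension collar -/

section Collar

variable {F}

/-- The **level of the collar** at parameter `θ` and depth `s`: the affine interpolation
between the height `τ₀ + s` (at `θ = 0`) and the height `φ₁ (τ₀ + s)` of the returning leaf
(at `θ = 1`). [folklore] -/
def collarLevel (τ₀ : ℝ) (φ₁ : ℝ → ℝ) (θ s : ℝ) : ℝ := (1 - θ) * (τ₀ + s) + θ * φ₁ (τ₀ + s)

/-- At depth `0` the collar level is the base level (when `φ₁ τ₀ = τ₀`). [folklore] -/
theorem collarLevel_zero_right {τ₀ : ℝ} {φ₁ : ℝ → ℝ} (h : φ₁ τ₀ = τ₀) (θ : ℝ) :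
    collarLevel τ₀ φ₁ θ 0 = τ₀ := by
  simp [collarLevel, h]; ring

/-- At `θ = 0` the collar level is `τ₀ + s`. [folklore] -/
@[simp] theorem collarLevel_zero_left (τ₀ : ℝ) (φ₁ : ℝ → ℝ) (s : ℝ) :
    collarLevel τ₀ φ₁ 0 s = τ₀ + s := by
  simp [collarLevel]

/-- At `θ = 1` the collar level is `φ₁ (τ₀ + s)`. [folklore] -/
@[simp] theorem collarLevel_one_left (τ₀ : ℝ) (φ₁ : ℝ → ℝ) (s : ℝ) :
    collarLevel τ₀ φ₁ 1 s = φ₁ (τ₀ + s) := by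
  simp [collarLevel]

/-- **The collar level is strictly increasing in the depth** for `θ ∈ [0, 1]`, when `φ₁` is
strictly increasing on the interval of depths. [folklore] -/
theorem strictMonoOn_collarLevel {τ₀ ε : ℝ} {φ₁ : ℝ → ℝ} (hφ : StrictMonoOn φ₁ (Ioo (τ₀ - ε) (τ₀ + ε)))
    {θ : ℝ} (hθ : θ ∈ Icc (0 : ℝ) 1) : StrictMonoOn (collarLevel τ₀ φ₁ θ) (Ioo (-ε) ε) := by
  intro s hs s' hs' hlt
  have h₁ : φ₁ (τ₀ + s) < φ₁ (τ₀ + s') :=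
    hφ ⟨by linarith [hs.1], by linarith [hs.2]⟩ ⟨by linarith [hs'.1], by linarith [hs'.2]⟩ (by linarith)
  simp only [collarLevel]
  rcases hθ.1.eq_or_lt with h | h
  · subst h; linarith
  · rcases hθ.2.eq_or_lt' with h' | h'
    · subst h'; linarith
    · nlinarith

/-- The collar level is continuous in `(θ, s)` for depths in the interval where `φ₁` is
continuous. [folklore] -/
theorem continuousOn_collarLevel {τ₀ ε : ℝ} {φ₁ : ℝ → ℝ} (hφ : ContinuousOn φ₁ (Ioo (τ₀ - ε) (τ₀ + ε))) :
    ContinuousOn (fun q : ℝ × ℝ ↦ collarLevel τ₀ φ₁ q.1 q.2) (univ ×ˢ Ioo (-ε) ε) := by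
  simp only [collarLevel]
  refine ((continuousOn_const.sub continuousOn_fst).mul (continuousOn_const.add continuousOn_snd)).add
    (continuousOn_fst.mul (hφ.comp (continuousOn_const.add continuousOn_snd) ?_))
  rintro q ⟨-, hq⟩
  exact ⟨by linarith [hq.1], by linarith [hq.2]⟩

/-- **The collar level stays in the level interval for small depths**, uniformly in
`θ ∈ [0, 1]`. [folklore] -/
theorem exists_forall_collarLevel_mem {τ₀ ε : ℝ} (hε : 0 < ε) {φ₁ : ℝ → ℝ}
    (hφ : ContinuousOn φ₁ (Ioo (τ₀ - ε) (τ₀ + ε))) (hφτ₀ : φ₁ τ₀ = τ₀) :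
    ∃ s₁ > (0 : ℝ), s₁ < ε ∧ ∀ θ ∈ Icc (0 : ℝ) 1, ∀ s ∈ Ioo (-s₁) s₁,
      collarLevel τ₀ φ₁ θ s ∈ Ioo (τ₀ - ε) (τ₀ + ε) := by
  have hca : ContinuousAt φ₁ τ₀ := hφ.continuousAt (IsHomeoGermAt.Ioo_mem_nhds_of_pos hε)
  have hsh : ContinuousAt (fun s : ℝ ↦ φ₁ (τ₀ + s)) 0 :=
    (show ContinuousAt φ₁ (τ₀ + 0) by rwa [add_zero]).comp (continuousAt_const.add continuousAt_id)
  have hmem : (fun s : ℝ ↦ φ₁ (τ₀ + s)) ⁻¹' Ioo (τ₀ - ε) (τ₀ + ε) ∈ 𝓝 (0 : ℝ) :=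
    hsh.preimage_mem_nhds (by rw [add_zero, hφτ₀]; exact IsHomeoGermAt.Ioo_mem_nhds_of_pos hε)
  obtain ⟨s₁, hs₁, hsub⟩ := IsHomeoGermAt.exists_Ioo_subset_of_mem_nhds (inter_mem hmem
    (IsHomeoGermAt.Ioo_mem_nhds_of_pos hε))
  refine ⟨min s₁ (ε / 2), lt_min hs₁ (by linarith), lt_of_le_of_lt (min_le_right _ _) (by linarith),
    fun θ hθ s hs ↦ ?_⟩
  have hs' : s ∈ Ioo (0 - s₁) (0 + s₁) :=
    ⟨by linarith [hs.1, min_le_left s₁ (ε / 2)], by linarith [hs.2, min_le_left s₁ (ε / 2)]⟩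
  obtain ⟨h₁, h₂⟩ := hsub hs'
  simp only [mem_preimage, mem_Ioo] at h₁
  rw [zero_sub, zero_add] at h₂
  simp only [collarLevel, mem_Ioo]
  have ha₁ : τ₀ - ε < τ₀ + s := by linarith [h₂.1]
  have ha₂ : τ₀ + s < τ₀ + ε := by linarith [h₂.2]
  rcases eq_or_lt_of_le hθ.2 with h | h
  · subst h
    constructor <;> linarith [h₁.1, h₁.2]
  · have h1θ : 0 < 1 - θ := by linarith
    constructor
    · linarith [mul_pos h1θ (sub_pos.2 ha₁), mul_nonneg hθ.1 (sub_pos.2 h₁.1).le]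
    · linarith [mul_pos h1θ (sub_pos.2 ha₂), mul_nonneg hθ.1 (sub_pos.2 h₁.2).le]

/-- **The suspension collar map**: the fence composed with the collar level. [folklore] -/
def collarMap (Φ : I → ℝ → M) (τ₀ : ℝ) (φ₁ : ℝ → ℝ) (θ : I) (s : ℝ) : M :=
  Φ θ (collarLevel τ₀ φ₁ θ s)

variable {Γ : I → F.GermSpace} {τ₀ ε : ℝ} {Φ : I → ℝ → M} {φ₁ ψ₁ : ℝ → ℝ} {ℓ : Path x₀ x₀}

/-- **At depth `0` the collar is the loop.** [folklore] -/
theorem collarMap_zero (hΦ : IsFenceOn F Γ τ₀ ε Φ univ) (hbase : ∀ θ, ofLeafSpace (Γ θ).pt = ℓ θ)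
    (hφτ₀ : φ₁ τ₀ = τ₀) (θ : I) : collarMap Φ τ₀ φ₁ θ 0 = ℓ θ := by
  rw [collarMap, collarLevel_zero_right hφτ₀, hΦ.base θ (mem_univ _), hbase]

/-- **The collar closes up**: at every depth, its values at `θ = 0` and at `θ = 1` coincide
(both equal `V (τ₀ + s)`, the point at height `τ₀ + s` on the vertical of `e₀` through `x₀`),
because the leaf of level `φ₁ (τ₀ + s)` returns over `x₀` at height `ψ₁ (φ₁ (τ₀ + s)) = τ₀ + s`.
[folklore] -/
theorem collarMap_zero_eq_collarMap_one {b₀ : B}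
    (h0 : ∀ τ ∈ Ioo (τ₀ - ε) (τ₀ + ε), Φ 0 τ = e₀.symm (b₀, τ))
    (h1 : ∀ τ ∈ Ioo (τ₀ - ε) (τ₀ + ε), Φ 1 τ = e₀.symm (b₀, ψ₁ τ))
    (hinv : ∀ τ ∈ Ioo (τ₀ - ε) (τ₀ + ε), ψ₁ (φ₁ τ) = τ ∧ φ₁ (ψ₁ τ) = τ) {s : ℝ}
    (hs : τ₀ + s ∈ Ioo (τ₀ - ε) (τ₀ + ε)) (hs' : φ₁ (τ₀ + s) ∈ Ioo (τ₀ - ε) (τ₀ + ε)) :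
    collarMap Φ τ₀ φ₁ 0 s = collarMap Φ τ₀ φ₁ 1 s ∧ collarMap Φ τ₀ φ₁ 0 s = e₀.symm (b₀, τ₀ + s) := by
  have e0 : collarMap Φ τ₀ φ₁ 0 s = e₀.symm (b₀, τ₀ + s) := by
    rw [collarMap, show ((0 : I) : ℝ) = 0 from rfl, collarLevel_zero_left, h0 _ hs]
  refine ⟨?_, e0⟩
  rw [e0, collarMap, show ((1 : I) : ℝ) = 1 from rfl, collarLevel_one_left, h1 _ hs', (hinv _ hs).1]

/-- **The collar is continuous** on `I × (-s₁, s₁)` when the collar levels stay in the level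
interval of the fence there. [folklore] -/
theorem continuousOn_collarMap (hΦ : IsFenceOn F Γ τ₀ ε Φ univ) (hφ : ContinuousOn φ₁ (Ioo (τ₀ - ε) (τ₀ + ε)))
    {s₁ : ℝ} (hs₁ : s₁ ≤ ε)
    (hlev : ∀ θ ∈ Icc (0 : ℝ) 1, ∀ s ∈ Ioo (-s₁) s₁, collarLevel τ₀ φ₁ θ s ∈ Ioo (τ₀ - ε) (τ₀ + ε)) :
    ContinuousOn (uncurry (collarMap Φ τ₀ φ₁)) (univ ×ˢ Ioo (-s₁) s₁) := by
  have hL : ContinuousOn (fun q : I × ℝ ↦ ((q.1 : I), collarLevel τ₀ φ₁ q.1 q.2)) (univ ×ˢ Ioo (-s₁) s₁) := by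
    refine continuousOn_fst.prodMk ?_
    have h := continuousOn_collarLevel hφ
    refine h.comp (continuous_subtype_val.fst'.continuousOn.prodMk continuousOn_snd) ?_
    rintro q ⟨-, hq⟩
    exact ⟨mem_univ _, ⟨by linarith [hq.1], by linarith [hq.2]⟩⟩
  refine hΦ.cont.comp hL ?_
  rintro q ⟨-, hq⟩
  exact ⟨mem_univ _, hlev q.1 ⟨q.1.2.1, q.1.2.2⟩ q.2 hq⟩

/-- **The verticals of the collar are injective** in the depth (levels strictly increase with
the depth and the fence verticals are injective on the level interval). [folklore] -/
theorem injOn_collarMap (hΦ : IsFenceOn F Γ τ₀ ε Φ univ) (hφ : StrictMonoOn φ₁ (Ioo (τ₀ - ε) (τ₀ + ε)))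
    {s₁ : ℝ} (hs₁ : s₁ ≤ ε)
    (hlev : ∀ θ ∈ Icc (0 : ℝ) 1, ∀ s ∈ Ioo (-s₁) s₁, collarLevel τ₀ φ₁ θ s ∈ Ioo (τ₀ - ε) (τ₀ + ε))
    (θ : I) : InjOn (collarMap Φ τ₀ φ₁ θ) (Ioo (-s₁) s₁) := by
  intro s hs s' hs' h
  have hθ : (θ : ℝ) ∈ Icc (0 : ℝ) 1 := ⟨θ.2.1, θ.2.2⟩
  have hinj := hΦ.injOn (mem_univ θ) (hlev θ hθ s hs) (hlev θ hθ s' hs') h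
  have hmono := strictMonoOn_collarLevel hφ hθ
  exact (hmono.injOn (Ioo_subset_Ioo (by linarith) hs₁ hs) (Ioo_subset_Ioo (by linarith) hs₁ hs')) hinj

/-- **The horizontals of the collar lie in leaves**: the point of the collar at `(θ, s)` lies
on the leaf of the point `Φ 0 (collarLevel θ s)` of the vertical through `x₀` (the horizontal
of the fence at that level is a leaf path). [folklore] -/
theorem collarMap_mem_leaf (hΦ : IsFenceOn F Γ τ₀ ε Φ univ) {θ : I} {s : ℝ}
    (hlev : collarLevel τ₀ φ₁ θ s ∈ Ioo (τ₀ - ε) (τ₀ + ε)) :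
    collarMap Φ τ₀ φ₁ θ s ∈ F.leaf (Φ 0 (collarLevel τ₀ φ₁ θ s)) :=
  hΦ.mem_leaf hlev 0 θ

end Collar

end Foliation

end Literature.Topology.FourManifolds
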